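import Literature.NumberTheory.Rogawski1990.LocalTransfer                         -- ★ `IsLocalDeltaTransfer` (4.3.1) on the `cmDatum` carriers, `IsLocalGRegular`, `IsLocalStablyConjH`, `LocalTransferFactor`, `stableOrbitalIntegralRel`
import Literature.NumberTheory.Automorphic.LocalUnitaryIntegralLevel                -- ★ `cmLocalIntegralLevel L N H v` — `K_v = U(H)(𝒪_v)`, `K_H = U(Φ₂)(𝒪_v) × U(Φ₁)(𝒪_v)`
import Literature.NumberTheory.Automorphic.SphericalEigencharacterStarCharacter     -- ★ `IsLevel.mulConv` (bi-`K`-invariance of `f ⋆ h`); cone ★ `IsLevel` (`SmoothCharacter`), ★ `mulConv`, ★ `hasCompactSupport_mulConv`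
import HarnessLib

/-!
# R90-TF · S9 «InnerForm-13.3.6 (c)» — (R5-LOC) THE ROW-5 `h.T`-LOCAL LEMMA, HYPOTHESIS-FIRST: at ONE finite place `v`, a Δ-transfer of `f″_v ⋆ h_v` is a Δ-transfer of
# `f′_v ⋆ h_v` as soon as `f′_v`, `f″_v` are SPHERICAL with a COMMON Δ-transfer — from the Hecke fundamental lemma in algebra-hom form (FL-HOM)_v and SO-injectivity on the
# spherical Hecke algebra of `H_v` (SO-INJ)_v, both as named hypotheses (Rogawski 1990 §4.9 Prop. 4.9.1 (b) p. 55; §14.6 p. 242 l. 10–22 «`f′ ⋆ h`, `f^H ⋆ b(h)`»)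

Cell `hodgecm-mathlib`, crux H413 (`stmt-HodgeConjecture-24833`, lane `--supports … --as helper`), route of record `HCCMUnconditional` (no route verbs; count-neutral).
Programme R90-TF (HUMAN RULING «R90-TF SLAB — MAX PUSH»; brief `director/R90-BRIEF.v2.md` 1f40d54518340a35), section S9 = InnerForm-13.3.6 (c) (base `R90-IF`); seat
R90-IF-p01 (g3).  DEALT BY NAME: R90-IF-plan (g3) DEALS #2 (g3) (R90 bus 2026-09-05T04:18:40Z) «(R5-LOC) ROW-5 `h.T`-LOCAL LEMMA, HYPOTHESIS-FIRST», on RULING S9-R-5-1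
(04:17:08Z provisional, FINAL 04:18:40Z: rows 5 `twH ∕ hTHw ∕ hEH` of S9 FILE B's producer `SocketRecordDatumLawsCm` STAY AS TYPED; payer = the ε-CHOICE twist
`twH l h fH := transfer of the pair at ONE chosen level-test preimage ε(fH)`; booking = transfer existence (B) + Hecke-FL algebra-hom letter (S10∕S6) + SO-injectivity letter
(S4∕S6, NEW) + THIS local lemma (S9) + the ε-twist organ (S9, later)) and on R90-IF-p04 (g3)'s clause-by-clause check 04:18:06Z (census `R90/R90-IF-p04/g3/CENSUS-row5-twH-HeckeFL.md`
§8 ERRATUM): at a place `v ∈ h.T` (so `v ∉ l`, and `f′_v`, `ε(fH)_v =: f″_v`, `h_v` are all `K_v`-spherical) the ε-choice payer needs exactly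
«`κ-OI(f′_v) = SO(fH_v) = κ-OI(f″_v)` ⟹ `κ-OI(f′_v ⋆ h_v) = κ-OI(f″_v ⋆ h_v) = SO(fH″_v)`», which is THIS file's theorem.  THEOREMS ONLY (no `def`, no instance, no
notation, no named fact, no `sorry`); imports ★ Literature only; namespace `Summit.HodgeConjecture.HodgeConjecture.R90.S9`.
HONEST LABEL: HC_CM is proved only modulo the 7 printed citations (2 remaining named inputs: hLiu418 = stmt-HodgeConjecture-24832, h413 = stmt-HodgeConjecture-24833) until
rung 0 closes.  This file is BOOKKEEPING over two NAMED LETTERS taken as hypotheses — (FL-HOM)_v (owner S10∕S6: [Rogawski1990, Prop. 4.9.1 (b)], [BlasiusRogawski1992])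
and (SO-INJ)_v (owner S4∕S6, new, size M) — it pays no socket by itself; rows 5 stay OPEN named inputs; REL ≠ ★ ≠ BUILT.

## The statement (one finite place `v` of `L⁺`; S4 currency)
Carriers: `G′_v := (cmDatum L 3 H).Local v` (the inner form `U(H)` at `v`), `H_v := (cmDatum L 2 Φ₂).Local v × (cmDatum L 1 Φ₁).Local v` (the endoscopic group, ★
`LocalTransfer`'s spelling), `K_v := cmLocalIntegralLevel L 3 H v`, `K_H := (cmLocalIntegralLevel L 2 Φ₂ v).prod (cmLocalIntegralLevel L 1 Φ₁ v)` (S10's spelling);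
«spherical» = compactly supported and bi-`K`-invariant (★ `IsLevel`); `f → f^H` = ★ `IsLocalDeltaTransfer L H v Δ mH mG fH f` («for every `G`-regular `γ_H`,
`Φ^st(γ_H, fH) = Σ_{[γ]} Δ_v(γ_H, γ) Φ([γ], f)`», shape «`A(fH) = B(f)`»); convolution = ★ `mulConv ν` on `G′_v`, ★ `mulConv νH` on `H_v` (measures are PARAMETERS; the
payer of (FL-HOM)_v fixes the normalisation, e.g. `ν(K_v) = νH(K_H) = 1`).
LETTERS (hypotheses): (FL-HOM)_v — a map `b : (G′_v → ℂ) → (H_v → ℂ)` sending spherical functions to spherical Δ-transfers of themselves, multiplicative for `⋆`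
(«`κ-OI = SO_H ∘ b` on `𝓗(G′_v, K_v)`, `b` an algebra homomorphism» — the Hecke fundamental lemma at the frame, [Rogawski1990, §4.9 Prop. 4.9.1 (b)]); (SO-INJ)_v —
two spherical functions on `H_v` with the same stable orbital integrals at every `G`-regular `γ_H` are EQUAL (Weyl integration + stability of the unramified tempered
characters of `H_v` + injectivity of the Satake transform; stated in the two-function form, so that no linearity of ★ `stableOrbitalIntegralRel` in `fH` is presumed).
CONCLUSION: if `ψ` is a Δ-transfer of BOTH spherical `f′` and `f″`, `h` is spherical, and `ψ″` is a Δ-transfer of `f″ ⋆ h`, then `ψ″` is a Δ-transfer of `f′ ⋆ h`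
(`ψ`, `ψ″` arbitrary — NOT assumed spherical: R90-IF-p04 (g3)'s point that `fH_v` is any Δ-partner of the level test).
PROOF (formal): `B(f′) = A(ψ) = B(f″)` on the `G`-regular set; (FL-HOM) `A(b f′) = B(f′)`, `A(b f″) = B(f″)` ⟹ `A(b f′) = A(b f″)` ⟹ (SO-INJ) `b f′ = b f″`;
`B(f′ ⋆ h) = A(b(f′ ⋆ h)) = A(b f′ ⋆ b h) = A(b f″ ⋆ b h) = A(b(f″ ⋆ h)) = B(f″ ⋆ h) = A(ψ″)` (sphericity of `f ⋆ h`: ★ `IsLevel.mulConv`, ★ `hasCompactSupport_mulConv`).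

## What is here (sorry-free, axioms ⊆ {propext, Classical.choice, Quot.sound})
* §1 `b_eq_of_common_transfer` — the first half alone: spherical `f′`, `f″` with a common Δ-transfer have `b f′ = b f″` ((FL-HOM) `hbT hbS` + (SO-INJ) `hinj`).
* §2 **`isLocalDeltaTransfer_convHecke_of_letters`** — THE ROW-5 `h.T`-LOCAL LEMMA (conclusion above).
* §2 `isLocalDeltaTransfer_convHecke_b_of_letters` — the same with the CANONICAL partner `b(f′ ⋆ h) = b f′ ⋆ b h` made explicit: `b f″ ⋆ b h` is a Δ-transfer of `f′ ⋆ h`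
  (the shape the ε-twist organ meets when it builds `twH` from `b`).

[cite: Rogawski1990, §4.3 (4.3.1) p. 43; §4.9 Prop. 4.9.1 (b) p. 55, Lemma 4.9.2 pp. 55–56; §13.7 p. 206; §14.6 p. 242 l. 10–22 (chunk p0236 L6–11)]
[cite: BlasiusRogawski1992, Thm. 1] [cite: CartierCorvallis1979, §IV.1 Thm. 4.1, Cor. 4.1]
-/

set_option autoImplicit false
-- the mandated namespace repeats `HodgeConjecture.HodgeConjecture`, as in every `Theorems/*.lean` of this sub-problem
set_option linter.dupNamespace false

noncomputable section

open NumberField IsDedekindDomain MeasureTheory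
open scoped Matrix
open Literature.NumberTheory Literature.NumberTheory.Automorphic Literature.NumberTheory.Automorphic.UnitaryGroup
open Literature.NumberTheory.Rogawski1990

namespace Summit.HodgeConjecture.HodgeConjecture.R90.S9

section RowFiveLocal

variable (L : Type) [Field L] [NumberField L] [IsCMField L] (H : Matrix (Fin 3) (Fin 3) L) (v : HeightOneSpectrum (𝓞 ↥(maximalRealSubfield L)))
  -- the measurable structures at `v` (B's instance binders): on `G′_v`, on `H_v`, and on the centralizer quotients of ★ `IsLocalDeltaTransfer`
  [MeasurableSpace ((cmDatum L 3 H).Local v)] [BorelSpace ((cmDatum L 3 H).Local v)]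
  [MeasurableSpace ((cmDatum L 2 (Matrix.of fun i j : Fin 2 => if i.val + j.val + 1 = 2 then (1 : L) else 0)).Local v ×
    (cmDatum L 1 (Matrix.of fun i j : Fin 1 => if i.val + j.val + 1 = 1 then (1 : L) else 0)).Local v)]
  [∀ a : ((cmDatum L 2 (Matrix.of fun i j : Fin 2 => if i.val + j.val + 1 = 2 then (1 : L) else 0)).Local v ×
      (cmDatum L 1 (Matrix.of fun i j : Fin 1 => if i.val + j.val + 1 = 1 then (1 : L) else 0)).Local v),
    MeasurableSpace (((cmDatum L 2 (Matrix.of fun i j : Fin 2 => if i.val + j.val + 1 = 2 then (1 : L) else 0)).Local v ×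
      (cmDatum L 1 (Matrix.of fun i j : Fin 1 => if i.val + j.val + 1 = 1 then (1 : L) else 0)).Local v) ⧸
      Subgroup.centralizer ({a} : Set ((cmDatum L 2 (Matrix.of fun i j : Fin 2 => if i.val + j.val + 1 = 2 then (1 : L) else 0)).Local v ×
        (cmDatum L 1 (Matrix.of fun i j : Fin 1 => if i.val + j.val + 1 = 1 then (1 : L) else 0)).Local v)))]
  [∀ γ : (cmDatum L 3 H).Local v, MeasurableSpace ((cmDatum L 3 H).Local v ⧸ Subgroup.centralizer ({γ} : Set ((cmDatum L 3 H).Local v)))]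
  -- the local transfer factor and the orbital measure families (B: `𝔨.Δ v`, `𝔨.mH v`, `𝔨.mG v`)
  (Δ : LocalTransferFactor L H v)
  (mH : OrbitalMeasureFamily ((cmDatum L 2 (Matrix.of fun i j : Fin 2 => if i.val + j.val + 1 = 2 then (1 : L) else 0)).Local v ×
    (cmDatum L 1 (Matrix.of fun i j : Fin 1 => if i.val + j.val + 1 = 1 then (1 : L) else 0)).Local v))
  (mG : OrbitalMeasureFamily ((cmDatum L 3 H).Local v))
  -- (FL-HOM)_v as DATA + LAWS: `b : 𝓗(G′_v, K_v) → 𝓗(H_v, K_H)`, transfer-valued (`hbT`), spherical-valued (`hbS`); its multiplicativity `hbM` (which mentions the two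
  -- convolution measures) is a binder of the §2 theorems [Rogawski1990, Prop. 4.9.1 (b)] (owner S10 ∕ S6)
  (b : ((cmDatum L 3 H).Local v → ℂ) →
    (((cmDatum L 2 (Matrix.of fun i j : Fin 2 => if i.val + j.val + 1 = 2 then (1 : L) else 0)).Local v ×
      (cmDatum L 1 (Matrix.of fun i j : Fin 1 => if i.val + j.val + 1 = 1 then (1 : L) else 0)).Local v) → ℂ))
  (hbT : ∀ φ : (cmDatum L 3 H).Local v → ℂ, HasCompactSupport φ → IsLevel (cmLocalIntegralLevel L 3 H v) φ →
    IsLocalDeltaTransfer L H v Δ mH mG (b φ) φ)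
  (hbS : ∀ φ : (cmDatum L 3 H).Local v → ℂ, HasCompactSupport φ → IsLevel (cmLocalIntegralLevel L 3 H v) φ →
    HasCompactSupport (b φ) ∧
      IsLevel ((cmLocalIntegralLevel L 2 (Matrix.of fun i j : Fin 2 => if i.val + j.val + 1 = 2 then (1 : L) else 0) v).prod
        (cmLocalIntegralLevel L 1 (Matrix.of fun i j : Fin 1 => if i.val + j.val + 1 = 1 then (1 : L) else 0) v)) (b φ))
  -- (SO-INJ)_v: spherical functions on `H_v` are separated by their stable orbital integrals on the `G`-regular set (owner S4 ∕ S6, NEW)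
  (hinj : ∀ ψ₁ ψ₂ : ((cmDatum L 2 (Matrix.of fun i j : Fin 2 => if i.val + j.val + 1 = 2 then (1 : L) else 0)).Local v ×
      (cmDatum L 1 (Matrix.of fun i j : Fin 1 => if i.val + j.val + 1 = 1 then (1 : L) else 0)).Local v) → ℂ,
    HasCompactSupport ψ₁ →
      IsLevel ((cmLocalIntegralLevel L 2 (Matrix.of fun i j : Fin 2 => if i.val + j.val + 1 = 2 then (1 : L) else 0) v).prod
        (cmLocalIntegralLevel L 1 (Matrix.of fun i j : Fin 1 => if i.val + j.val + 1 = 1 then (1 : L) else 0) v)) ψ₁ →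
    HasCompactSupport ψ₂ →
      IsLevel ((cmLocalIntegralLevel L 2 (Matrix.of fun i j : Fin 2 => if i.val + j.val + 1 = 2 then (1 : L) else 0) v).prod
        (cmLocalIntegralLevel L 1 (Matrix.of fun i j : Fin 1 => if i.val + j.val + 1 = 1 then (1 : L) else 0) v)) ψ₂ →
    (∀ γH, IsLocalGRegular L v γH →
      stableOrbitalIntegralRel (IsLocalStablyConjH L v) mH ψ₁ γH = stableOrbitalIntegralRel (IsLocalStablyConjH L v) mH ψ₂ γH) →
    ψ₁ = ψ₂)

include b hbT hbS hinj

/-! ## §1 Spherical functions with a common Δ-transfer have the same `b`-image -/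

omit [MeasurableSpace ((cmDatum L 3 H).Local v)] [BorelSpace ((cmDatum L 3 H).Local v)]
  [MeasurableSpace ((cmDatum L 2 (Matrix.of fun i j : Fin 2 => if i.val + j.val + 1 = 2 then (1 : L) else 0)).Local v ×
    (cmDatum L 1 (Matrix.of fun i j : Fin 1 => if i.val + j.val + 1 = 1 then (1 : L) else 0)).Local v)] in
/-- **Two spherical `f′_v`, `f″_v` with a COMMON Δ-transfer `ψ` have `b f′_v = b f″_v`.**  From `A(ψ) = B(f′)` and `A(ψ) = B(f″)` on the `G`-regular set:
`A(b f′) = B(f′) = B(f″) = A(b f″)` there ((FL-HOM) `hbT`), and `b f′`, `b f″` are spherical on `H_v` ((FL-HOM) `hbS`), so (SO-INJ) `hinj` identifies them.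
(`ψ` is NOT assumed spherical.) [cite: Rogawski1990, §4.9 Prop. 4.9.1 (b) p. 55; §4.3 (4.3.1) p. 43] [cite: BlasiusRogawski1992, Thm. 1] -/
theorem b_eq_of_common_transfer
    (ψ : ((cmDatum L 2 (Matrix.of fun i j : Fin 2 => if i.val + j.val + 1 = 2 then (1 : L) else 0)).Local v ×
      (cmDatum L 1 (Matrix.of fun i j : Fin 1 => if i.val + j.val + 1 = 1 then (1 : L) else 0)).Local v) → ℂ)
    (f' f'' : (cmDatum L 3 H).Local v → ℂ)
    (hf' : HasCompactSupport f' ∧ IsLevel (cmLocalIntegralLevel L 3 H v) f') (hf'' : HasCompactSupport f'' ∧ IsLevel (cmLocalIntegralLevel L 3 H v) f'')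
    (h₁ : IsLocalDeltaTransfer L H v Δ mH mG ψ f') (h₂ : IsLocalDeltaTransfer L H v Δ mH mG ψ f'') :
    b f' = b f'' := by
  refine hinj (b f') (b f'') (hbS f' hf'.1 hf'.2).1 (hbS f' hf'.1 hf'.2).2 (hbS f'' hf''.1 hf''.2).1 (hbS f'' hf''.1 hf''.2).2 fun γH hγ => ?_
  -- `A(b f′) γH = B(f′) γH = A(ψ) γH = B(f″) γH = A(b f″) γH`
  rw [hbT f' hf'.1 hf'.2 γH hγ, hbT f'' hf''.1 hf''.2 γH hγ, ← h₁ γH hγ, ← h₂ γH hγ]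

/-! ## §2 THE ROW-5 `h.T`-LOCAL LEMMA -/

/-- **(R5-LOC) THE ROW-5 `h.T`-LOCAL LEMMA.**  At the finite place `v`, with the letters (FL-HOM)_v (`b`, `hbT`, `hbS`, `hbM`) and (SO-INJ)_v (`hinj`) as hypotheses: if `ψ` is a
Δ-transfer of the SPHERICAL `f′` AND of the spherical `f″`, `h` is spherical, and `ψ″` is a Δ-transfer of `f″ ⋆ h`, then `ψ″` is a Δ-transfer of `f′ ⋆ h`.  This is the step
the ε-CHOICE payer of S9 FILE B's row 5 (`hTHw`) needs at the places `v ∈ h.T` of the Hecke twist (RULING S9-R-5-1): `f′` = the given level test, `f″ := ε(fH)` = the chosen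
level-test preimage of `fH`, `ψ := fH_v`, `ψ″ := (transfer of f″ ⋆ h)_v`.  PROOF: §1 gives `b f′ = b f″`; then `B(f′ ⋆ h) = A(b f′ ⋆ b h) = A(b f″ ⋆ b h) = B(f″ ⋆ h) = A(ψ″)`
(`hbT` on the spherical `f′ ⋆ h`, `f″ ⋆ h` — ★ `IsLevel.mulConv`, ★ `hasCompactSupport_mulConv` — and `hbM` twice). [cite: Rogawski1990, §14.6 p. 242 l. 10–22 (chunk p0236 L6–11); §4.9 Prop. 4.9.1 (b) p. 55; §13.7 p. 206]
[cite: BlasiusRogawski1992, Thm. 1] [cite: CartierCorvallis1979, §IV.1 Cor. 4.1] -/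
theorem isLocalDeltaTransfer_convHecke_of_letters
    -- the local Haar measures of the two convolutions (B: `νG v` in `twistTest`; the `H`-side one is the (FL-HOM) payer's) and the MULTIPLICATIVITY of `b`
    (ν : Measure ((cmDatum L 3 H).Local v)) [ν.IsMulLeftInvariant]
    (νH : Measure ((cmDatum L 2 (Matrix.of fun i j : Fin 2 => if i.val + j.val + 1 = 2 then (1 : L) else 0)).Local v ×
      (cmDatum L 1 (Matrix.of fun i j : Fin 1 => if i.val + j.val + 1 = 1 then (1 : L) else 0)).Local v))
    (hbM : ∀ φ₁ φ₂ : (cmDatum L 3 H).Local v → ℂ, HasCompactSupport φ₁ → IsLevel (cmLocalIntegralLevel L 3 H v) φ₁ →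
      HasCompactSupport φ₂ → IsLevel (cmLocalIntegralLevel L 3 H v) φ₂ → b (mulConv ν φ₁ φ₂) = mulConv νH (b φ₁) (b φ₂))
    (ψ ψ'' : ((cmDatum L 2 (Matrix.of fun i j : Fin 2 => if i.val + j.val + 1 = 2 then (1 : L) else 0)).Local v ×
      (cmDatum L 1 (Matrix.of fun i j : Fin 1 => if i.val + j.val + 1 = 1 then (1 : L) else 0)).Local v) → ℂ)
    (f' f'' h : (cmDatum L 3 H).Local v → ℂ)
    (hf' : HasCompactSupport f' ∧ IsLevel (cmLocalIntegralLevel L 3 H v) f') (hf'' : HasCompactSupport f'' ∧ IsLevel (cmLocalIntegralLevel L 3 H v) f'')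
    (hh : HasCompactSupport h ∧ IsLevel (cmLocalIntegralLevel L 3 H v) h)
    (h₁ : IsLocalDeltaTransfer L H v Δ mH mG ψ f') (h₂ : IsLocalDeltaTransfer L H v Δ mH mG ψ f'')
    (h₃ : IsLocalDeltaTransfer L H v Δ mH mG ψ'' (mulConv ν f'' h)) :
    IsLocalDeltaTransfer L H v Δ mH mG ψ'' (mulConv ν f' h) := by
  have hb : b f' = b f'' := b_eq_of_common_transfer L H v Δ mH mG b hbT hbS hinj ψ f' f'' hf' hf'' h₁ h₂
  -- the twisted functions are spherical
  have hf'h : HasCompactSupport (mulConv ν f' h) ∧ IsLevel (cmLocalIntegralLevel L 3 H v) (mulConv ν f' h) :=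
    ⟨hasCompactSupport_mulConv ν hf'.1 hh.1, hf'.2.mulConv ν hh.2⟩
  have hf''h : HasCompactSupport (mulConv ν f'' h) ∧ IsLevel (cmLocalIntegralLevel L 3 H v) (mulConv ν f'' h) :=
    ⟨hasCompactSupport_mulConv ν hf''.1 hh.1, hf''.2.mulConv ν hh.2⟩
  intro γH hγ
  -- `A(ψ″) = B(f″ ⋆ h) = A(b(f″ ⋆ h)) = A(b f″ ⋆ b h) = A(b f′ ⋆ b h) = A(b(f′ ⋆ h)) = B(f′ ⋆ h)` at `γH`
  rw [← hbT (mulConv ν f' h) hf'h.1 hf'h.2 γH hγ, hbM f' h hf'.1 hf'.2 hh.1 hh.2, hb, ← hbM f'' h hf''.1 hf''.2 hh.1 hh.2,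
    hbT (mulConv ν f'' h) hf''h.1 hf''h.2 γH hγ]
  exact h₃ γH hγ

/-- **The canonical partner**: under the same letters and hypotheses, `b f″ ⋆ b h` — the `H`-side Hecke twist of the `b`-image of the chosen preimage — is a Δ-transfer of
`f′ ⋆ h` (the shape met when `twH` is built from `b` directly: `b f″ ⋆ b h = b(f″ ⋆ h) = b(f′ ⋆ h)`). [cite: Rogawski1990, §14.6 p. 242 l. 18–22; §4.9 Prop. 4.9.1 (b) p. 55] -/
theorem isLocalDeltaTransfer_convHecke_b_of_letters
    -- the local Haar measures of the two convolutions (B: `νG v` in `twistTest`; the `H`-side one is the (FL-HOM) payer's) and the MULTIPLICATIVITY of `b`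
    (ν : Measure ((cmDatum L 3 H).Local v)) [ν.IsMulLeftInvariant]
    (νH : Measure ((cmDatum L 2 (Matrix.of fun i j : Fin 2 => if i.val + j.val + 1 = 2 then (1 : L) else 0)).Local v ×
      (cmDatum L 1 (Matrix.of fun i j : Fin 1 => if i.val + j.val + 1 = 1 then (1 : L) else 0)).Local v))
    (hbM : ∀ φ₁ φ₂ : (cmDatum L 3 H).Local v → ℂ, HasCompactSupport φ₁ → IsLevel (cmLocalIntegralLevel L 3 H v) φ₁ →
      HasCompactSupport φ₂ → IsLevel (cmLocalIntegralLevel L 3 H v) φ₂ → b (mulConv ν φ₁ φ₂) = mulConv νH (b φ₁) (b φ₂))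
    (ψ : ((cmDatum L 2 (Matrix.of fun i j : Fin 2 => if i.val + j.val + 1 = 2 then (1 : L) else 0)).Local v ×
      (cmDatum L 1 (Matrix.of fun i j : Fin 1 => if i.val + j.val + 1 = 1 then (1 : L) else 0)).Local v) → ℂ)
    (f' f'' h : (cmDatum L 3 H).Local v → ℂ)
    (hf' : HasCompactSupport f' ∧ IsLevel (cmLocalIntegralLevel L 3 H v) f') (hf'' : HasCompactSupport f'' ∧ IsLevel (cmLocalIntegralLevel L 3 H v) f'')
    (hh : HasCompactSupport h ∧ IsLevel (cmLocalIntegralLevel L 3 H v) h)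
    (h₁ : IsLocalDeltaTransfer L H v Δ mH mG ψ f') (h₂ : IsLocalDeltaTransfer L H v Δ mH mG ψ f'') :
    IsLocalDeltaTransfer L H v Δ mH mG (mulConv νH (b f'') (b h)) (mulConv ν f' h) := by
  have hb : b f' = b f'' := b_eq_of_common_transfer L H v Δ mH mG b hbT hbS hinj ψ f' f'' hf' hf'' h₁ h₂
  have hf'h : HasCompactSupport (mulConv ν f' h) ∧ IsLevel (cmLocalIntegralLevel L 3 H v) (mulConv ν f' h) :=
    ⟨hasCompactSupport_mulConv ν hf'.1 hh.1, hf'.2.mulConv ν hh.2⟩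
  rw [← hb, ← hbM f' h hf'.1 hf'.2 hh.1 hh.2]
  exact hbT (mulConv ν f' h) hf'h.1 hf'h.2

end RowFiveLocal

end Summit.HodgeConjecture.HodgeConjecture.R90.S9

end
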